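import Literature.Probability.Percolation.VoronoiSeparating
import Literature.Probability.Percolation.VoronoiArmEstimates
import Literature.Probability.Percolation.SmirnovContinuumLimit
import Literature.Probability.RandomPlanarGeometry.MarkedDomainCorners
import Literature.Topology.PlaneTopology.JordanLoopCornerCut
import HarnessLib

/-!
# Stub `stub_voronoiEquicont` of line `Sketch` (crux `Target`, stmt-CriticalPhenomena-6431)

Approximate equicontinuity of the annealed Voronoi separating probabilities
`f_δⁱ(z) = voronoiSepProb (PB.prod PW) (forgetLast R) δ i z` on `closure Ω`, eventually in the
mesh `δ`, FROM Tassion's two estimates `VoronoiAnnealedOneArm` (F1) and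
`VoronoiAnnealedBlackCircuit` (F2) (named facts of `VoronoiArmEstimates.lean`): the estimate of
Bollobás–Riordan's proof of Claim 22 (*Percolation* (2006), Ch. 7 p. 198), for a general
`3`-marked Jordan domain (`voronoiSepProb_sub_le`) and then for `forgetLast R`
(`stub_voronoiEquicont`, the registered signature).

Proof.  `f(z) - f(z') ≤ P(E(z) ∖ E(z'))`.  On `E(z) ∖ E(z')` with `z, z'` joined by a short path
`τ` in `closure Ω ∩ B(z, ε)` (uniform local path-connectedness of `closure Ω`,
`exists_joinedIn_closure_ball`), the black separating path `γ` of `z` meets `B̄(z, ε)` (else it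
would separate `z'` too).  Either `γ` reaches distance `ρ` from `z` — a black arm from `B̄(z, ε)`
to `{dist ≥ ρ}` (F1) — or `γ`, which starts on `A_{i+1}` and ends on `A_{i+2}`, stays in
`B(z, ρ)`, forcing `z` to be `θ`-close to the corner `c = pt (i + 2)` (compactness,
`exists_corner_radius`); then `z`, hence `z'`, is joined to `c` inside `closure Ω ∩ B(c, r)`, and
a black Jordan circuit around `c` in the annulus `{r < dist < ρ_c}` (present up to an F2 event)
contains a black path in `closure Ω` from `A_{i+1}` to `A_{i+2}` cutting `z'` from `Aᵢ`
(`MarkedDomain.exists_traverse_cut`, `JordanLoopCornerCut.lean`: traverse of the loop + Newman's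
cross-cut theorem) — i.e. `E(z')`, excluded.  Hence `P(E z ∖ E z') ≤ β/2 + β/2`.
-/

noncomputable section

namespace Summit.CriticalPhenomena.CardyFormulaZ2.Theorems.CardyFlipRussoTarget

open MeasureTheory Filter Set Metric
open scoped Topology
open Literature.Analysis.FunctionSpaces
open Literature.Probability.RandomPlanarGeometry
open Literature.Probability.RandomPlanarGeometry.MarkedDomain (forgetLast)
open Literature.Probability.LatticeModels
open Literature.Probability.Percolation
open Literature.Topology.PlaneTopology

/-! ### Geometry of the corners of a `3`-marked domain -/

/-- The far arc `Aᵢ` keeps a uniform positive distance from the corner `pt (i + 2)`. -/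
theorem equicont_exists_far_radius (D : MarkedDomain 3) :
    ∃ ρc > (0 : ℝ), ∀ i : Fin 3, ∀ a ∈ D.arc i, ρc < dist a (D.pt (i + 2)) := by
  obtain ⟨c, hc, hle⟩ := D.exists_pos_le_infDist_pt_arc
  refine ⟨c / 2, half_pos hc, fun i a ha => ?_⟩
  have hfin : ∀ j : Fin 3, ¬ (j + 2 = j ∨ j + 2 = j + 1) := by decide
  have hnot : D.pt (i + 2) ∉ D.arc i := by
    rw [D.pt_mem_arc_iff]
    exact hfin i
  have h1 := hle (i + 2) i hnot
  have h2 : infDist (D.pt (i + 2)) (D.arc i) ≤ dist (D.pt (i + 2)) a := infDist_le_dist_of_mem ha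
  rw [dist_comm] at h2
  linarith

/-- **Corner radius**: a point `ρ`-close to both arcs `A_{i+1}`, `A_{i+2}` is `θ`-close to their
common corner `pt (i + 2)` (compactness; uniform in `i`). -/
theorem equicont_exists_corner_radius (D : MarkedDomain 3) {θ : ℝ} (hθ : 0 < θ) :
    ∃ ρ > (0 : ℝ), ∀ (i : Fin 3) (z : ℂ), infDist z (D.arc (i + 1)) < ρ →
      infDist z (D.arc (i + 2)) < ρ → dist z (D.pt (i + 2)) < θ := by
  have key : ∀ i : Fin 3, ∃ ρ > (0 : ℝ), ∀ z : ℂ, infDist z (D.arc (i + 1)) < ρ →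
      infDist z (D.arc (i + 2)) < ρ → dist z (D.pt (i + 2)) < θ := by
    intro i
    set c := D.pt (i + 2) with hc
    set K : Set ℂ := D.arc (i + 1) ∩ (ball c (θ / 2))ᶜ with hK
    have hKc : IsCompact K := (D.isCompact_arc (i + 1)).inter_right isOpen_ball.isClosed_compl
    have hne' : ∀ j : Fin 3, (j + 2 : Fin 3) ≠ j + 1 := by decide
    have hfin : ∀ j : Fin 3, ¬ (j + 1 = j + 2 ∨ j + 1 = j + 2 + 1) := by decide
    have hsucc : ∀ j : Fin 3, j + 1 + 1 = j + 2 := by decide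
    have hdisj : Disjoint K (D.arc (i + 2)) := by
      rw [Set.disjoint_left]
      rintro w ⟨hw1, hwball⟩ hw2
      rcases D.mem_arc_inter_arc (hne' i) hw1 hw2 with h | h
      · have : D.pt (i + 1) ∈ D.arc (i + 2) := h ▸ hw2
        rw [D.pt_mem_arc_iff] at this
        exact hfin i this
      · rw [hsucc] at h
        exact hwball (by rw [h]; exact mem_ball_self (half_pos hθ))
    obtain ⟨d₀, hd₀, hdist⟩ := exists_pos_forall_le_dist hKc (D.isClosed_arc (i + 2)) hdisj
    refine ⟨min (d₀ / 2) (θ / 4), by positivity, fun z h1 h2 => ?_⟩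
    obtain ⟨x, hx, hzx⟩ := (infDist_lt_iff ⟨_, D.pt_mem_arc_self (i + 1)⟩).1 h1
    obtain ⟨y, hy, hzy⟩ := (infDist_lt_iff ⟨_, D.pt_mem_arc_self (i + 2)⟩).1 h2
    have hxy : dist x y < d₀ := by
      calc dist x y ≤ dist z x + dist z y := dist_triangle_left x y z
        _ < min (d₀ / 2) (θ / 4) + min (d₀ / 2) (θ / 4) := add_lt_add hzx hzy
        _ ≤ d₀ / 2 + d₀ / 2 := add_le_add (min_le_left _ _) (min_le_left _ _)
        _ = d₀ := by ring
    have hxball : x ∈ ball c (θ / 2) := by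
      by_contra hxb
      exact (not_le.2 hxy) (hdist x ⟨hx, hxb⟩ y hy)
    calc dist z c ≤ dist z x + dist x c := dist_triangle z x c
      _ < min (d₀ / 2) (θ / 4) + θ / 2 := add_lt_add hzx (mem_ball.1 hxball)
      _ ≤ θ / 4 + θ / 2 := by gcongr; exact min_le_right _ _
      _ < θ := by linarith
  choose ρ hρ hP using key
  have hne : (Finset.univ : Finset (Fin 3)).Nonempty := ⟨0, Finset.mem_univ _⟩
  refine ⟨Finset.univ.inf' hne ρ, (Finset.lt_inf'_iff hne).2 fun i _ => hρ i, fun i z h1 h2 => ?_⟩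
  have hle : Finset.univ.inf' hne ρ ≤ ρ i := Finset.inf'_le _ (Finset.mem_univ i)
  exact hP i z (h1.trans_le hle) (h2.trans_le hle)

/-! ### The deterministic core: arm or missing circuit -/

/-- **On `E(z) ∖ E(z')`, either a black arm at `z` or no black circuit around the corner.**
Deterministic core of the equicontinuity estimate (Bollobás–Riordan, proof of Claim 22, p. 198):
`z, z'` are joined by `τ` in `closure Ω ∩ B(z, ε')` (`ε' ≤ ε`, `ε' ≤ r/2`); if `z` is `θ`-close to
the corner it is joined to it in `closure Ω ∩ B(z, r/2)`; `θ ≤ r/2`; points `ρ`-close to both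
adjacent arcs are `θ`-close to the corner; the far arc is farther than `ρc` from the corner. -/
theorem equicont_arm_or_noCircuit {D : MarkedDomain 3} {i : Fin 3} {δ ε ε' ρ θ r ρc : ℝ}
    {z z' : ℂ} {B W : Set ℂ}
    (hρc0 : 0 ≤ ρc) (hρc : ∀ a ∈ D.arc i, ρc < dist a (D.pt (i + 2)))
    (hθr : θ ≤ r / 2) (hε'ε : ε' ≤ ε) (hε'r : ε' ≤ r / 2)
    (hcorner : infDist z (D.arc (i + 1)) < ρ → infDist z (D.arc (i + 2)) < ρ →
      dist z (D.pt (i + 2)) < θ)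
    (hjc : dist z (D.pt (i + 2)) < θ →
      JoinedIn (closure D.carrier ∩ ball z (r / 2)) z (D.pt (i + 2)))
    (hτ : JoinedIn (closure D.carrier ∩ ball z ε') z z') (hzz' : dist z z' < ε')
    (hE : voronoiSepEvent D δ i z B W) (hE' : ¬ voronoiSepEvent D δ i z' B W) :
    (∃ (a b : ℂ) (γ : Path a b), dist a z ≤ ε ∧ ρ ≤ dist b z ∧
        ∀ t, (γ t : ℂ) / (δ : ℂ) ∈ blackRegion B W) ∨
      ¬ ∃ Γ : ℝ → ℂ, IsJordanLoop Γ ∧ D.pt (i + 2) ∈ IsJordanLoop.inside Γ ∧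
        ∀ t, r < dist (Γ t) (D.pt (i + 2)) ∧ dist (Γ t) (D.pt (i + 2)) < ρc ∧
          Γ t / (δ : ℂ) ∈ blackRegion B W := by
  obtain ⟨x, hx, y, hy, γ, hγ, hcut⟩ := hE
  set c := D.pt (i + 2) with hc
  -- the separating path comes `ε`-close to `z`
  have hnear : ∃ t₀, dist (γ t₀) z ≤ ε := by
    by_contra hfar
    push Not at hfar
    refine hE' ⟨x, hx, y, hy, γ, hγ, ?_, fun a ha hj => ?_⟩
    · rintro ⟨t, ht⟩
      have := hfar t
      rw [ht, dist_comm] at this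
      linarith [hzz'.trans_le hε'ε]
    · have hzz'j : JoinedIn (closure D.carrier \ range γ) z z' := by
        refine hτ.mono ?_
        rintro p ⟨hp, hpz⟩
        refine ⟨hp, ?_⟩
        rintro ⟨t, rfl⟩
        have := hfar t
        rw [mem_ball] at hpz
        linarith
      exact hcut.2 a ha (hzz'j.trans hj)
  obtain ⟨t₀, ht₀⟩ := hnear
  by_cases hA : ∃ t₁, ρ ≤ dist (γ t₁) z
  · -- a black arm
    left
    obtain ⟨t₁, ht₁⟩ := hA
    obtain ⟨a, b, γ', ha, hb, hsub⟩ := exists_subpath γ t₀ t₁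
    refine ⟨a, b, γ', by rw [ha]; exact ht₀, by rw [hb]; exact ht₁, fun t => ?_⟩
    obtain ⟨s, hs⟩ := hsub ⟨t, rfl⟩
    rw [← hs]
    exact (hγ s).2
  · -- the corner case
    right
    push Not at hA
    have h1 : infDist z (D.arc (i + 1)) < ρ := by
      refine (infDist_le_dist_of_mem hx).trans_lt ?_
      rw [dist_comm, ← γ.source]
      exact hA 0
    have h2 : infDist z (D.arc (i + 2)) < ρ := by
      refine (infDist_le_dist_of_mem hy).trans_lt ?_
      rw [dist_comm, ← γ.target]
      exact hA 1
    have hzc : dist z c < θ := hcorner h1 h2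
    rintro ⟨Γ, hΓJ, hcin, hΓ⟩
    have hout : D.arc i ⊆ IsJordanLoop.outside Γ := fun a ha =>
      mem_outside_of_lt_dist hρc0 (fun t => (hΓ t).2.1) (hρc a ha)
    obtain ⟨x', y', L, hx', hy', hLΓ, hLcl, hLcut⟩ := D.exists_traverse_cut i hΓJ hcin hout
    -- `z'` is joined to the corner off `Γ`
    have hballΓ : closure D.carrier ∩ ball z (r / 2) ⊆ closure D.carrier \ range Γ := by
      rintro p ⟨hp, hpz⟩
      refine ⟨hp, ?_⟩
      rintro ⟨t, rfl⟩
      have hlt := (hΓ t).1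
      rw [mem_ball] at hpz
      linarith [dist_triangle (Γ t) z c]
    have hjcz' : JoinedIn (closure D.carrier \ range Γ) c z' :=
      ((hjc hzc).mono hballΓ).symm.trans
        (hτ.mono ((inter_subset_inter_right _ (ball_subset_ball hε'r)).trans hballΓ))
    obtain ⟨hz'L, hcutL⟩ := hLcut z' hjcz'
    refine hE' ⟨x', hx', y', hy', L, fun t => ⟨hLcl t, ?_⟩, hz'L, hcutL⟩
    obtain ⟨s, hs⟩ := hLΓ ⟨t, rfl⟩
    rw [mem_setOf_eq, ← hs]
    exact (hΓ s).2.2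

/-! ### The estimate -/

/-- **Approximate equicontinuity of annealed Voronoi separating probabilities from F1 and F2**
(Bollobás–Riordan, proof of Claim 22, p. 198), for a general `3`-marked Jordan domain: for
`β > 0` there is `η > 0` such that eventually as `δ → 0⁺`, `f_δⁱ(z) - f_δⁱ(z') ≤ β` whenever
`z, z' ∈ closure Ω`, `dist z z' < η`. -/
theorem voronoiSepProb_sub_le (hF1 : VoronoiAnnealedOneArm) (hF2 : VoronoiAnnealedBlackCircuit)
    {PB PW : Measure (PointConfig ℂ)} (hB : IsPoissonPointProcess (volume : Measure ℂ) PB)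
    (hW : IsPoissonPointProcess (volume : Measure ℂ) PW) (D : MarkedDomain 3) {β : ℝ}
    (hβ : 0 < β) :
    ∃ η > (0 : ℝ), ∀ᶠ δ : ℝ in 𝓝[>] 0, ∀ (i : Fin 3),
      ∀ z ∈ closure D.carrier, ∀ z' ∈ closure D.carrier, dist z z' < η →
        voronoiSepProb (PB.prod PW) D δ i z - voronoiSepProb (PB.prod PW) D δ i z' ≤ β := by
  haveI := hB.isProbabilityMeasure
  haveI := hW.isProbabilityMeasure
  obtain ⟨ρc, hρc0, hρc⟩ := equicont_exists_far_radius D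
  obtain ⟨r, ⟨hr0, -⟩, hF2ev⟩ := hF2.exists_radius hB hW (half_pos hβ) hρc0
  obtain ⟨η₁, hη₁, hjoin₁⟩ := exists_joinedIn_closure_ball D.toJordanDomain (half_pos hr0)
  set θ : ℝ := min (r / 2) η₁ with hθ
  have hθ0 : 0 < θ := lt_min (half_pos hr0) hη₁
  obtain ⟨ρ, hρ0, hcorner⟩ := equicont_exists_corner_radius D hθ0
  obtain ⟨ε, ⟨hε0, -⟩, hF1ev⟩ := hF1.exists_radius hB hW (half_pos hβ) hρ0
  set ε' : ℝ := min ε (r / 2) with hε'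
  have hε'0 : 0 < ε' := lt_min hε0 (half_pos hr0)
  obtain ⟨η₂, hη₂, hjoin₂⟩ := exists_joinedIn_closure_ball D.toJordanDomain hε'0
  refine ⟨min η₂ ε', lt_min hη₂ hε'0, ?_⟩
  filter_upwards [hF1ev, hF2ev] with δ hδ1 hδ2
  intro i z hz z' hz' hzz'
  set P := PB.prod PW with hP
  set Ez : Set (PointConfig ℂ × PointConfig ℂ) :=
    {c | voronoiSepEvent D δ i z (c.1 : Set ℂ) (c.2 : Set ℂ)} with hEz
  set Ez' : Set (PointConfig ℂ × PointConfig ℂ) :=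
    {c | voronoiSepEvent D δ i z' (c.1 : Set ℂ) (c.2 : Set ℂ)} with hEz'
  set ARM : Set (PointConfig ℂ × PointConfig ℂ) :=
    {c | ∃ (a b : ℂ) (γ : Path a b), dist a z ≤ ε ∧ ρ ≤ dist b z ∧
      ∀ t, (γ t : ℂ) / (δ : ℂ) ∈ blackRegion (c.1 : Set ℂ) (c.2 : Set ℂ)} with hARM
  set NOC : Set (PointConfig ℂ × PointConfig ℂ) :=
    {c | ¬ ∃ Γ : ℝ → ℂ, IsJordanLoop Γ ∧ D.pt (i + 2) ∈ IsJordanLoop.inside Γ ∧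
      ∀ t, r < dist (Γ t) (D.pt (i + 2)) ∧ dist (Γ t) (D.pt (i + 2)) < ρc ∧
        Γ t / (δ : ℂ) ∈ blackRegion (c.1 : Set ℂ) (c.2 : Set ℂ)} with hNOC
  have hτ : JoinedIn (closure D.carrier ∩ ball z ε') z z' :=
    hjoin₂ z hz z' hz' (hzz'.trans_le (min_le_left _ _))
  have hdiff : Ez \ Ez' ⊆ ARM ∪ NOC := by
    rintro c ⟨hEzc, hEz'c⟩
    exact equicont_arm_or_noCircuit hρc0.le (hρc i) (min_le_left _ _) (min_le_left _ _)
      (min_le_right _ _) (hcorner i z)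
      (fun hzc => hjoin₁ z hz _ (frontier_subset_closure (D.pt_mem_frontier (i + 2)))
        (hzc.trans_le (min_le_right _ _)))
      hτ (hzz'.trans_le (min_le_right _ _)) hEzc hEz'c
  have h1 : P.real Ez ≤ P.real (Ez \ Ez') + P.real Ez' :=
    (measureReal_mono (fun c hc => (em (c ∈ Ez')).elim Or.inr fun h => Or.inl ⟨hc, h⟩)).trans
      (measureReal_union_le _ _)
  have h2 : P.real (Ez \ Ez') ≤ P.real ARM + P.real NOC :=
    (measureReal_mono hdiff).trans (measureReal_union_le _ _)
  have h3 : P.real ARM ≤ β / 2 := hδ1 z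
  have h4 : P.real NOC ≤ β / 2 := hδ2 (D.pt (i + 2))
  show P.real Ez - P.real Ez' ≤ β
  linarith

/-- STUB 3b of line `Sketch` — **approximate equicontinuity of the annealed Voronoi separating
probabilities of `forgetLast R` from Tassion's estimates F1, F2** (Bollobás–Riordan, proof of
Claim 22, p. 198): the registered signature, by `voronoiSepProb_sub_le`. -/
theorem stub_voronoiEquicont : VoronoiAnnealedOneArm → VoronoiAnnealedBlackCircuit →
    ∀ (PB PW : Measure (PointConfig ℂ)),
    IsPoissonPointProcess (volume : Measure ℂ) PB → IsPoissonPointProcess (volume : Measure ℂ) PW →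
    ∀ (R : ConformalRectangle), ∀ β > (0 : ℝ), ∃ η > (0 : ℝ), ∀ᶠ δ : ℝ in 𝓝[>] 0, ∀ (i : Fin 3),
      ∀ z ∈ closure R.carrier, ∀ z' ∈ closure R.carrier, dist z z' < η →
        voronoiSepProb (PB.prod PW) (forgetLast R) δ i z -
          voronoiSepProb (PB.prod PW) (forgetLast R) δ i z' ≤ β := by
  intro hF1 hF2 PB PW hB hW R β hβ
  exact voronoiSepProb_sub_le hF1 hF2 hB hW (forgetLast R) hβ

end Summit.CriticalPhenomena.CardyFormulaZ2.Theorems.CardyFlipRussoTarget
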